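import Mathlib
import Literature.NumberTheory.LFunctions.Zhang2022.Section11XiZeroTrueSize
import Literature.NumberTheory.Sieve.ShiuDivisorClass
import HarnessLib

/-!
# Zhang (2022) §7 p. 33 / §§11–12: the TRUE-SIZE short-window mean of `ξ₀ⱼ(n;d,r)` —
# `Σ_{x<n≤x′} |ξ₀ⱼ(n;d,r)|/n ≪ 2^{ω(r)}·(x′ − x)/x`

Topic `Literature/NumberTheory/LFunctions/Zhang2022` (Landau–Siegel audit tree; verdict-neutral).
Y. Zhang, *Discrete mean estimates and the Landau–Siegel zero*, arXiv:2211.02515v1 (2022)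
[Zhang2022LandauSiegel], §7 p. 33 (the objects `ξ₀ⱼ(n;d,r)` of Proposition 7.1), §11 p. 64
(tex L3299, the window mean square "by (11.3), (8.25) and (8.26)", `Z22:§11.u019`) and §12
p. 67 (tex L3409–L3418, the `P^{0.5}`-window sequence behind (12.6): "by (8.25) and (8.26)",
`Z22:(12.6)`, GAP row G-d42-2) — **an unrefereed manuscript under adjudication; nothing here
asserts or denies its Theorems 1–2.** ZHANG-L discharge lane (WP11 → helper for WP12).

For a window-supported `𝐚₂` the `n`-sum `Σ_n a₂(drn)ξ₀ⱼ(n;d,r)/n` of `S_j(𝐚₁,𝐚₂)` runs over a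
short multiplicative window `(x, xη]`; with `|a₂| ≍ 1` (the §12 case) only the TRUE size of
`|ξ₀ⱼ|` (log-mean exponent `1`, `Section11XiZeroTrueSize`) combined with a SHORT-INTERVAL mean
value meets the budget. This file PROVES that combination (theorems only, no new objects):

* `norm_xiZero_halved_mul_of_coprime`, `…_prime_le`, `…_prime_pow_le` — the halved function
  `F(n) = |ξ₀ⱼ(n;d,r)|/2^{#{q∣n : q∣r}}` (written out) is multiplicative on coprime arguments with
  `F(1) = 1`, `F(p) ≤ 1 + 21B log p + (12+56S₃)/p` at EVERY prime and `F(p^ν) ≤ 7(2+S₃)(ν+1)⁴`;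
* `sum_norm_xiZero_window_div_le` — **Shiu's theorem for the divisor class (tree
  `Sieve.ShiuDivisorClass.shiu_divisor_class_logMean_Ioc`, `a = 1`, zl-w11-p3) applied to `F`**:
  there are ABSOLUTE `C, x₀` with, for all `c′, D, j`, `d, r ≥ 1`, `x₀ ≤ x`, `x + x^{1/4} ≤ x′ ≤ 2x`:
  `Σ_{⌊x⌋<n≤⌊x′⌋} |ξ₀ⱼ(n;d,r)|/n ≤ C·2^{ω(r)}·exp(21B·log(4x) + (12+56S₃))·(x′ − x)/x`;
* `sum_norm_xiZero_window_div_le_of_large` — for `D ≥ ⌈exp(5|c′|π+3)⌉` and `x ≤ 4P`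
  (`B ≤ 9π𝓛⁻⁹`, `log 4x ≤ 6𝓛⁹`): `≤ C·e^{1134π+12+56S₃}·2^{ω(r)}·(x′ − x)/x` — no power of `𝓛`.

With `x′ = xη₊/η₋` (`η_± = e^{±𝓛⁻¹⁰}`) the right side is `≍ 2^{ω(r)}𝓛⁻¹⁰`: the window analogue of
`sum_norm_xiZero_div_le_ell9`, and the input of a two-window bound
`|S_j(𝐚₁,𝐚₂)| ≪ B₁B₂·𝓛⁻¹⁰` for window-supported bounded `𝐚₁, 𝐚₂` (the "(8.25)/(8.26)" surrogate
the §12 sequence of (12.6) needs). No statement about Landau–Siegel zeros is made or implied.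

## References

* Y. Zhang, arXiv:2211.02515v1 (2022), §7 Prop. 7.1 p. 33; §11 p. 64; §12 p. 67.
  [cite: Zhang2022LandauSiegel, §7 p.33; §11 p.64; §12 p.67]
* P. Shiu, J. reine angew. Math. 313 (1980), 161–170, Theorem 1. [cite: Shiu1980, Theorem 1]
-/

noncomputable section

open Finset Real ArithmeticFunction

namespace Literature.NumberTheory.LFunctions.Zhang2022.XiZeroMajorant

open MeanSquareMajorant

variable (c' : ℝ) (D : ℕ)

/-! ### The halved function `F(n) = |ξ₀ⱼ(n;d,r)|/2^{#{q ∣ n : q ∣ r}}` -/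

/-- `#{q ∣ mn : q ∣ r} = #{q ∣ m : q ∣ r} + #{q ∣ n : q ∣ r}` for coprime `m, n ≠ 0`. [folklore] -/
private theorem card_pf_filter_dvd_mul (r : ℕ) {m n : ℕ} (hmn : Nat.Coprime m n) (hm : m ≠ 0)
    (hn : n ≠ 0) : ((m * n).primeFactors.filter (fun q => q ∣ r)).card =
      (m.primeFactors.filter (fun q => q ∣ r)).card + (n.primeFactors.filter (fun q => q ∣ r)).card := by
  rw [Nat.primeFactors_mul hm hn, filter_union,
    card_union_of_disjoint (disjoint_filter_filter hmn.disjoint_primeFactors)]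

/-- `#{q ∣ n : q ∣ r} ≤ ω(r)` for `r ≠ 0`. [folklore] -/
private theorem card_pf_filter_dvd_le (n : ℕ) {r : ℕ} (hr : r ≠ 0) :
    (n.primeFactors.filter (fun q => q ∣ r)).card ≤ r.primeFactors.card := by
  refine card_le_card fun q hq => ?_
  rw [mem_filter] at hq
  exact Nat.mem_primeFactors.mpr ⟨Nat.prime_of_mem_primeFactors hq.1, hq.2, hr⟩

/-- **`F` is multiplicative on coprime arguments** (`ξ₀ⱼ(·;d,r)` is, `Lemma83.xiZero_mul_of_coprime`,
and the prime factors of coprime numbers are disjoint), `d, r ≥ 1`.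
[cite: Zhang2022LandauSiegel, §7 p.33] -/
theorem norm_xiZero_halved_mul_of_coprime (j : ℕ) {d r : ℕ} (hd : d ≠ 0) (hr : r ≠ 0) {m n : ℕ}
    (hmn : Nat.Coprime m n) :
    ‖Skeleton.xiZero c' D j (m * n) d r‖ /
        (2 : ℝ) ^ ((m * n).primeFactors.filter (fun q => q ∣ r)).card =
      (‖Skeleton.xiZero c' D j m d r‖ / (2 : ℝ) ^ (m.primeFactors.filter (fun q => q ∣ r)).card) *
        (‖Skeleton.xiZero c' D j n d r‖ / (2 : ℝ) ^ (n.primeFactors.filter (fun q => q ∣ r)).card) := by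
  rcases Nat.eq_zero_or_pos m with rfl | hm
  · simp only [Nat.coprime_zero_left] at hmn
    subst hmn
    simp [Lemma83.xiZero_apply_zero]
  rcases Nat.eq_zero_or_pos n with rfl | hn
  · simp only [Nat.coprime_zero_right] at hmn
    subst hmn
    simp [Lemma83.xiZero_apply_zero]
  rw [Lemma83.xiZero_mul_of_coprime c' D j hd hr hmn, norm_mul,
    card_pf_filter_dvd_mul r hmn hm.ne' hn.ne', pow_add, mul_div_mul_comm]

/-- `F(1) = 1`. [cite: Zhang2022LandauSiegel, §7 p.33] -/
theorem norm_xiZero_halved_one (j d r : ℕ) :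
    ‖Skeleton.xiZero c' D j 1 d r‖ / (2 : ℝ) ^ ((1 : ℕ).primeFactors.filter (fun q => q ∣ r)).card = 1 := by
  simp [Lemma83.xiZero_apply_one]

/-- **`F(p) ≤ 1 + 21B log p + (12+56S₃)/p` at EVERY prime** (`p ∤ r`: `norm_xiZero_prime_le_of_not_dvd`;
`p ∣ r`: `|κ(p)|/2 ≤ 1 + B log p/2`). [cite: Zhang2022LandauSiegel, §7 p.33; App. A pp.102–103] -/
theorem norm_xiZero_halved_prime_le (j : ℕ) {d r : ℕ} {p : ℕ} (hp : p.Prime) :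
    ‖Skeleton.xiZero c' D j p d r‖ / (2 : ℝ) ^ (p.primeFactors.filter (fun q => q ∣ r)).card ≤
      1 + 21 * Bsum c' D * Real.log p + (12 + 56 * LogEulerProduct.tailConst 3) / p := by
  have hT := LogEulerProduct.tailConst_nonneg 3
  have hB := Bsum_nonneg c' D
  have hp2 : (2 : ℝ) ≤ p := by exact_mod_cast hp.two_le
  have hlog0 : 0 ≤ Real.log p := Real.log_nonneg (by linarith)
  have hM : 0 ≤ (12 + 56 * LogEulerProduct.tailConst 3) / (p : ℝ) := div_nonneg (by linarith) (by linarith)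
  rw [hp.primeFactors, filter_singleton]
  by_cases hpr : p ∣ r
  · rw [if_pos hpr, card_singleton, pow_one, div_le_iff₀ (by norm_num : (0 : ℝ) < 2)]
    refine (norm_xiZero_prime_le_of_dvd c' D hp j (d := d) hpr).trans ?_
    nlinarith [mul_nonneg hB hlog0]
  · rw [if_neg hpr, card_empty, pow_zero, div_one]
    exact norm_xiZero_prime_le_of_not_dvd c' D hp j (d := d) hpr

/-- **`F(p^ν) ≤ 7(2+S₃)(ν+1)⁴`** at every prime power (`F ≤ |ξ₀ⱼ| ≤ gC`, `gC_prime_pow_le`).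
[cite: Zhang2022LandauSiegel, §7 p.33] -/
theorem norm_xiZero_halved_prime_pow_le (j d r : ℕ) {p : ℕ} (hp : p.Prime) (ν : ℕ) :
    ‖Skeleton.xiZero c' D j (p ^ ν) d r‖ / (2 : ℝ) ^ ((p ^ ν).primeFactors.filter (fun q => q ∣ r)).card ≤
      7 * (2 + LogEulerProduct.tailConst 3) * ((ν : ℝ) + 1) ^ 4 := by
  refine (div_le_self (norm_nonneg _) (one_le_pow₀ (by norm_num))).trans ?_
  exact (norm_xiZero_le_gC c' D (pow_ne_zero ν hp.ne_zero) j d r).trans (gC_prime_pow_le c' D hp ν)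

/-- `|ξ₀ⱼ(n;d,r)| ≤ 2^{ω(r)}·F(n)` (`r ≠ 0`). [cite: Zhang2022LandauSiegel, §7 p.33] -/
theorem norm_xiZero_le_two_pow_mul_halved (j d : ℕ) {r : ℕ} (hr : r ≠ 0) (n : ℕ) :
    ‖Skeleton.xiZero c' D j n d r‖ ≤ (2 : ℝ) ^ r.primeFactors.card *
      (‖Skeleton.xiZero c' D j n d r‖ / (2 : ℝ) ^ (n.primeFactors.filter (fun q => q ∣ r)).card) := by
  have h2 : (0 : ℝ) < (2 : ℝ) ^ (n.primeFactors.filter (fun q => q ∣ r)).card := by positivity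
  rw [mul_div_assoc', le_div_iff₀ h2]
  calc ‖Skeleton.xiZero c' D j n d r‖ * (2 : ℝ) ^ (n.primeFactors.filter (fun q => q ∣ r)).card
      ≤ ‖Skeleton.xiZero c' D j n d r‖ * (2 : ℝ) ^ r.primeFactors.card :=
        mul_le_mul_of_nonneg_left
          (pow_le_pow_right₀ (by norm_num) (card_pf_filter_dvd_le n hr)) (norm_nonneg _)
    _ = (2 : ℝ) ^ r.primeFactors.card * ‖Skeleton.xiZero c' D j n d r‖ := mul_comm _ _

/-! ### Shiu's theorem for `F`: the true-size short-window mean of `ξ₀ⱼ` -/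

/-- **The true-size short-window mean of `ξ₀ⱼ`.** There are absolute `C ≥ 0`, `x₀ ≥ 2` such that
for all `c′, D, j`, `d, r ≥ 1` and reals `x₀ ≤ x`, `x + x^{1/4} ≤ x′ ≤ 2x`:
`Σ_{⌊x⌋<n≤⌊x′⌋} |ξ₀ⱼ(n;d,r)|/n ≤ C·2^{ω(r)}·exp(21B·log(4x) + (12+56S₃))·(x′ − x)/x`
(`B = |b₁|+|b₂|+|b₃|`): Shiu's theorem in the divisor-class form
(`Sieve.ShiuDivisorClass.shiu_divisor_class_logMean_Ioc` with `a = 1`, `d = 4`, `C₅ = 7(2+S₃)`)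
applied to the halved function `F`, and `|ξ₀ⱼ| ≤ 2^{ω(r)}F`.
[cite: Zhang2022LandauSiegel, §7 p.33; §11 p.64; §12 p.67] -/
theorem sum_norm_xiZero_window_div_le :
    ∃ C x₀ : ℝ, 0 ≤ C ∧ 2 ≤ x₀ ∧ ∀ (c' : ℝ) (D j : ℕ) {d r : ℕ}, d ≠ 0 → r ≠ 0 →
      ∀ x x' : ℝ, x₀ ≤ x → x + x ^ (1 / 4 : ℝ) ≤ x' → x' ≤ 2 * x →
        ∑ n ∈ Ioc ⌊x⌋₊ ⌊x'⌋₊, ‖Skeleton.xiZero c' D j n d r‖ / n ≤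
          C * (2 : ℝ) ^ r.primeFactors.card *
            Real.exp (21 * Bsum c' D * Real.log (4 * x) + (12 + 56 * LogEulerProduct.tailConst 3)) *
            ((x' - x) / x) := by
  obtain ⟨C, x₀, hC0, hx₀, h⟩ :=
    Literature.NumberTheory.Sieve.ShiuDivisorClass.shiu_divisor_class_logMean_Ioc 1 4
      (7 * (2 + LogEulerProduct.tailConst 3))
  refine ⟨C, x₀, hC0, hx₀, fun c' D j d r hd hr x x' hx hxx' hx'x => ?_⟩
  have hT := LogEulerProduct.tailConst_nonneg 3
  set F : ℕ → ℝ := fun n =>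
    ‖Skeleton.xiZero c' D j n d r‖ / (2 : ℝ) ^ (n.primeFactors.filter (fun q => q ∣ r)).card with hF
  have hF0 : ∀ n, 0 ≤ F n := fun n => by positivity
  have hFmul : ∀ m n : ℕ, m.Coprime n → F (m * n) = F m * F n := fun m n hmn =>
    norm_xiZero_halved_mul_of_coprime c' D j hd hr hmn
  have hFpow : ∀ p ν : ℕ, p.Prime → 1 ≤ ν → F (p ^ ν) ≤
      7 * (2 + LogEulerProduct.tailConst 3) * ((ν : ℝ) + 1) ^ 4 := fun p ν hp _ =>
    norm_xiZero_halved_prime_pow_le c' D j d r hp ν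
  have hFp : ∀ p : ℕ, p.Prime → (p : ℝ) ≤ x → F p ≤ (1 : ℕ) + 21 * Bsum c' D * Real.log p +
      (12 + 56 * LogEulerProduct.tailConst 3) / p := fun p hp _ => by
    push_cast; exact norm_xiZero_halved_prime_le c' D j hp
  have hx2 : 2 ≤ x := le_trans hx₀ hx
  have hx0 : 0 < x := by linarith
  have key := h F hF0 hFmul hFpow (21 * Bsum c' D) (12 + 56 * LogEulerProduct.tailConst 3)
    (by linarith [Bsum_nonneg c' D]) (by linarith) x x' hx hxx' hx'x hFp
  have hlogx : 0 < Real.log x := Real.log_pos (by linarith)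
  simp only [pow_one] at key
  rw [mul_div_assoc, div_self hlogx.ne', mul_one] at key
  -- `‖ξ₀ⱼ(n)‖/n ≤ 2^{ω(r)}·F(n)/n`
  calc ∑ n ∈ Ioc ⌊x⌋₊ ⌊x'⌋₊, ‖Skeleton.xiZero c' D j n d r‖ / n
      ≤ ∑ n ∈ Ioc ⌊x⌋₊ ⌊x'⌋₊, (2 : ℝ) ^ r.primeFactors.card * (F n / n) := by
        refine sum_le_sum fun n _ => ?_
        rw [← mul_div_assoc]
        exact div_le_div_of_nonneg_right (norm_xiZero_le_two_pow_mul_halved c' D j d hr n)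
          (Nat.cast_nonneg n)
    _ = (2 : ℝ) ^ r.primeFactors.card * ∑ n ∈ Ioc ⌊x⌋₊ ⌊x'⌋₊, F n / n := by rw [mul_sum]
    _ ≤ (2 : ℝ) ^ r.primeFactors.card *
          (C * Real.exp (21 * Bsum c' D * Real.log (4 * x) +
            (12 + 56 * LogEulerProduct.tailConst 3)) * ((x' - x) / x)) :=
        mul_le_mul_of_nonneg_left key (by positivity)
    _ = _ := by ring

/-- **The true-size short-window mean of `ξ₀ⱼ` on the range of Proposition 7.1.** With the
absolute `C, x₀` of `sum_norm_xiZero_window_div_le`: for `D ≥ ⌈exp(5|c′|π+3)⌉` (`𝓛 ≥ 3`,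
`B ≤ 9π𝓛⁻⁹`), all `j`, `d, r ≥ 1` and `x₀ ≤ x ≤ 4P`, `x + x^{1/4} ≤ x′ ≤ 2x`:
`Σ_{⌊x⌋<n≤⌊x′⌋} |ξ₀ⱼ(n;d,r)|/n ≤ C·e^{1134π + 12 + 56S₃}·2^{ω(r)}·(x′ − x)/x` — NO power of `𝓛`
(with `x′ = xη₊/η₋`, `η_± = e^{±𝓛⁻¹⁰}`, the right side is `≍ 2^{ω(r)}𝓛⁻¹⁰`).
[cite: Zhang2022LandauSiegel, §7 p.33; §11 p.64; §12 p.67] -/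
theorem sum_norm_xiZero_window_div_le_of_large :
    ∃ C x₀ : ℝ, 0 ≤ C ∧ 2 ≤ x₀ ∧ ∀ (c' : ℝ) (D : ℕ), ⌈Real.exp (5 * |c'| * π + 3)⌉₊ ≤ D →
      ∀ (j : ℕ) {d r : ℕ}, d ≠ 0 → r ≠ 0 →
      ∀ x x' : ℝ, x₀ ≤ x → x ≤ 4 * Skeleton.bigP D → x + x ^ (1 / 4 : ℝ) ≤ x' → x' ≤ 2 * x →
        ∑ n ∈ Ioc ⌊x⌋₊ ⌊x'⌋₊, ‖Skeleton.xiZero c' D j n d r‖ / n ≤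
          C * Real.exp (1134 * π + (12 + 56 * LogEulerProduct.tailConst 3)) *
            (2 : ℝ) ^ r.primeFactors.card * ((x' - x) / x) := by
  obtain ⟨C, x₀, hC0, hx₀, h⟩ := sum_norm_xiZero_window_div_le
  refine ⟨C, x₀, hC0, hx₀, fun c' D hD j d r hd hr x x' hx hxP hxx' hx'x => ?_⟩
  obtain ⟨hL3, hBle⟩ := three_le_ell_and_Bsum_le hD
  set ℓ := Skeleton.ell D with hℓ
  have hℓ9 : (3 : ℝ) ^ 9 ≤ ℓ ^ 9 := pow_le_pow_left₀ (by norm_num) hL3 9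
  have hℓ9' : (19683 : ℝ) ≤ ℓ ^ 9 := by norm_num at hℓ9 ⊢; linarith
  have hl9pos : 0 < ℓ ^ 9 := by positivity
  have hB := Bsum_nonneg c' D
  have hx2 : 2 ≤ x := le_trans hx₀ hx
  have hx0 : 0 < x := by linarith
  have hP : Skeleton.bigP D = Real.exp (ℓ ^ 9) := rfl
  have hlog16 : Real.log 16 ≤ 3 := by
    have : (16 : ℝ) ≤ Real.exp 3 := by
      have h27 : (2.7 : ℝ) < Real.exp 1 := lt_trans (by norm_num) Real.exp_one_gt_d9
      have h3 : Real.exp 3 = Real.exp 1 ^ 3 := by rw [← Real.exp_nat_mul]; norm_num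
      have hp : (2.7 : ℝ) ^ 3 < Real.exp 1 ^ 3 := pow_lt_pow_left₀ h27 (by norm_num) (by norm_num)
      rw [h3]; norm_num at hp; linarith
    calc Real.log 16 ≤ Real.log (Real.exp 3) := Real.log_le_log (by norm_num) this
      _ = 3 := Real.log_exp 3
  have hlog4x : Real.log (4 * x) ≤ 6 * ℓ ^ 9 := by
    have h16P : (4 : ℝ) * x ≤ 16 * Skeleton.bigP D := by linarith
    calc Real.log (4 * x) ≤ Real.log (16 * Skeleton.bigP D) := Real.log_le_log (by linarith) h16P
      _ = Real.log 16 + ℓ ^ 9 := by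
          rw [hP, Real.log_mul (by norm_num) (Real.exp_pos _).ne', Real.log_exp]
      _ ≤ 6 * ℓ ^ 9 := by linarith
  have hlog4x0 : 0 ≤ Real.log (4 * x) := Real.log_nonneg (by linarith)
  have hKlog : 21 * Bsum c' D * Real.log (4 * x) ≤ 1134 * π := by
    have hne : ℓ ^ 9 ≠ 0 := hl9pos.ne'
    calc 21 * Bsum c' D * Real.log (4 * x) ≤ 21 * (9 * π / ℓ ^ 9) * (6 * ℓ ^ 9) :=
          mul_le_mul (mul_le_mul_of_nonneg_left hBle (by norm_num)) hlog4x hlog4x0 (by positivity)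
      _ = 1134 * π := by field_simp; ring
  have hexp : Real.exp (21 * Bsum c' D * Real.log (4 * x) + (12 + 56 * LogEulerProduct.tailConst 3)) ≤
      Real.exp (1134 * π + (12 + 56 * LogEulerProduct.tailConst 3)) :=
    Real.exp_le_exp.mpr (by linarith)
  have hmain := h c' D j hd hr x x' hx hxx' hx'x
  have hratio : 0 ≤ (x' - x) / x := div_nonneg (by
    have : 0 ≤ x ^ (1 / 4 : ℝ) := by positivity
    linarith) hx0.le
  calc ∑ n ∈ Ioc ⌊x⌋₊ ⌊x'⌋₊, ‖Skeleton.xiZero c' D j n d r‖ / n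
      ≤ C * (2 : ℝ) ^ r.primeFactors.card *
          Real.exp (21 * Bsum c' D * Real.log (4 * x) + (12 + 56 * LogEulerProduct.tailConst 3)) *
          ((x' - x) / x) := hmain
    _ ≤ C * (2 : ℝ) ^ r.primeFactors.card *
          Real.exp (1134 * π + (12 + 56 * LogEulerProduct.tailConst 3)) * ((x' - x) / x) := by
        gcongr
    _ = _ := by ring

end Literature.NumberTheory.LFunctions.Zhang2022.XiZeroMajorant

end
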